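import Summits.NavierStokesRegularity.TurbBounds.Certs.N1bG2n12.EvalData2
import Summits.NavierStokesRegularity.TurbBounds.CouplingSplit
import Summits.NavierStokesRegularity.TurbBounds.TailN1bG2n12LadderForms
import Summits.NavierStokesRegularity.TurbBounds.TailN1bG2n12Ext
import Summits.NavierStokesRegularity.TurbBounds.QuadFormEval
import HarnessLib

/-!
# Row RB-N1b tail lemma (dim 42) — structured quadratic form of the literal rule piece `PT0`, part 4/16 (v2.1: list-level evaluation)
(cell `pub-turb` / `turb-bounds`; v2; GENERATED by pub-turb-cert gen 8 (prover-pub-turb-cert-g8-0) running the gen-7 tool `emit_pieces_v21.py N1bG2n12` from the staged `Certs/N1bG2n12/EvalData*.lean`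
literals; the identity says 'this literal (projected) piece IS the Legendre–Galerkin object of rbsdp SPEC 3.3–3.6 on the kept coordinates'
(LEAN-MAP data item (a) for row RB-N1b). Proof: `QuadFormEval.dotProduct_mulVec_eq_rowsEval` turns the quadratic form into a structural
recursion over the row lists (unfolded by `simp only`, linear in the 672 listed entries), then `ring` over the ladder forms.)

HONEST FRAMING: rigorous bounds for the stated PDE and boundary conditions; no claim about physical turbulence beyond the bound.
-/

set_option linter.style.longLine false
set_option linter.style.setOption false
set_option maxRecDepth 100000

noncomputable section

namespace Summit.NavierStokesRegularity.TurbBounds.TailN1bG2n12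

open Finset Matrix Literature.Computation.Certificates
open Summit.NavierStokesRegularity.TurbBounds.LadderTail (w phi lam)
open Summit.NavierStokesRegularity.TurbBounds.CouplingSplit (couplingMode)
open Summit.NavierStokesRegularity.TurbBounds.Certs.N1bG2n12.Evaluator

set_option maxHeartbeats 20000000 in
/-- structured quadratic form of the literal piece `PT0` (42×42 kept coordinates, 672 listed / 21 nonzero entries) -/
theorem quadForm_PT0 (x : Fin 42 → ℝ) :
    x ⬝ᵥ (PT0.map (Rat.cast : ℚ → ℝ) *ᵥ x) = 4 * ∑ n ∈ range 22, w n * xd x n ^ 2 := by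
  rw [show PT0 = matrixOfRows 42 42 PT0_rows from rfl,
    QuadFormEval.dotProduct_mulVec_eq_rowsEval PT0_rows x (ext x) (ext_val x) (ext_zero x)]
  simp only [PT0_rows, PT0_rows_r0, PT0_rows_r1, PT0_rows_r2, PT0_rows_r3, PT0_rows_r4, PT0_rows_r5, PT0_rows_r6, PT0_rows_r7, PT0_rows_r8, PT0_rows_r9, PT0_rows_r10, PT0_rows_r11, PT0_rows_r12, PT0_rows_r13, PT0_rows_r14, PT0_rows_r15, PT0_rows_r16, PT0_rows_r17, PT0_rows_r18, PT0_rows_r19, PT0_rows_r20, PT0_rows_r21, PT0_rows_r22, PT0_rows_r23, PT0_rows_r24, PT0_rows_r25, PT0_rows_r26, PT0_rows_r27, PT0_rows_r28, PT0_rows_r29, PT0_rows_r30, PT0_rows_r31, PT0_rows_r32, PT0_rows_r33, PT0_rows_r34, PT0_rows_r35, PT0_rows_r36, PT0_rows_r37, PT0_rows_r38, PT0_rows_r39, PT0_rows_r40, PT0_rows_r41,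
    QuadFormEval.rowsEval_cons, QuadFormEval.rowsEval_nil, QuadFormEval.rowEval_cons, QuadFormEval.rowEval_nil, ext, Rat.cast_zero, zero_mul, mul_zero, zero_add, add_zero,
    sum_range_succ, sum_range_zero, xd, w]
  push_cast
  ring

end Summit.NavierStokesRegularity.TurbBounds.TailN1bG2n12

end
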